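import Literature.Geometry.Lorentzian.KerrEnergyFromLocalEnergy
import Literature.Geometry.Lorentzian.KerrFiniteSpeedOfPropagation

/-!
# `a`-uniform energy boundedness modulo integrated local energy (stub `stub_energyFromLocalEnergy`,
# S7 of the line `olver-dunster-uniform-reduction`)

Crux `PhaseMixingCapture.KappaExplicitWaveDecay` (stmt-FinalStateConjecture-10654), line
`olver-dunster-uniform-reduction`, stub S7: for every `M > 0` there are a coordinate radius
`R₀ = 3M` and a constant `C₀ = C₀(M) < ∞` such that for EVERY sub-extremal `a`, every admissible wave
`ψ` on the Kerr exterior `{r > r₊}` (smooth, `□_g ψ = 0`, data compactly supported on the leaf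
`{t* = 0}`) and every `τ ≥ 0`,
`sliceEnergy(ψ, τ) ≤ C₀ · (E₁[ψ](0) + ∫_{(0,∞)} localSliceEnergy(ψ, s, R₀) ds)` — clause (a) of the
crux from clause (b) at one radius, with NO power of `κ`.

Proof. The real work is the proved Literature theorem
`Kerr.exterior_coordEnergy_le_local` (`Literature/Geometry/Lorentzian/KerrEnergyFromLocalEnergy.lean`):
the energy identity for the blended current `χ(−J^T) + (1 − χ)J^{∇t}` on the surgered Kerr–Schild
background (Killing `T = ∂_{t*}` on `{‖y‖ ≥ 3M}`, where it is uniformly timelike for `|a| < M`;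
the `dt`-current near the hole), with the receding horizon weight of
`KerrHorizonRegularWaveBoundednessProofs` (flux sign by the dominant energy condition) and monotone
convergence; its constant depends on `M` only. Here we (i) pass from `ψ` on the exterior chart to
its representative `Φ = extend ψ 0` (`Kerr.dalembertian_eq_waveOperator`), (ii) get the spatially
compact support of `dΦ` on the slab `{0 ≤ t* ≤ τ}` from the compact support of the data and the
PROVED finite speed of propagation `kerr_finite_speed_of_propagation_holds`, (iii) bound the
coordinate energy of the data by `4 E₁[ψ](0)` (`(∂_μΦ)² ≤ ‖DΦ‖² = ‖D¹Φ‖²`), and (iv) enlarge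
`∫_{(0,τ]}` to `∫_{(0,∞)}`. No named (unproved) fact is used.
-/

-- the doubled `FinalStateConjecture.FinalStateConjecture` path component trips dupNamespace
set_option linter.dupNamespace false

noncomputable section

namespace Summit.FinalStateConjecture.FinalStateConjecture.Theorems.KappaExplicitWaveDecay.OlverDunsterUniformReduction

open Literature.Geometry.Lorentzian
open MeasureTheory Filter Set Complex
open scoped Topology Manifold ENNReal ContDiff

/-- `(∂_μ Φ)² ≤ ‖D¹Φ‖²` for the coordinate vectors `∂_μ` (unit vectors of `E4`). -/
private theorem sq_fderiv_basisVector_le (Φ : E4 → ℝ) (x : E4) (μ : Fin 4) :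
    fderiv ℝ Φ x (E4.basisVector μ) ^ 2 ≤ ‖iteratedFDeriv ℝ 1 Φ x‖ ^ 2 := by
  have hv : ‖E4.basisVector μ‖ = 1 := by simp [E4.basisVector]
  have happ : |fderiv ℝ Φ x (E4.basisVector μ)| ≤ ‖iteratedFDeriv ℝ 1 Φ x‖ := by
    have := (iteratedFDeriv ℝ 1 Φ x).le_opNorm ![E4.basisVector μ]
    rw [iteratedFDeriv_one_apply] at this
    simpa [Real.norm_eq_abs, hv] using this
  have h0 : 0 ≤ ‖iteratedFDeriv ℝ 1 Φ x‖ := norm_nonneg _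
  calc fderiv ℝ Φ x (E4.basisVector μ) ^ 2 = |fderiv ℝ Φ x (E4.basisVector μ)| ^ 2 := (sq_abs _).symm
    _ ≤ ‖iteratedFDeriv ℝ 1 Φ x‖ ^ 2 := pow_le_pow_left₀ (abs_nonneg _) happ 2

/-- The coordinate energy density is at most `4 ∑_{m ≤ 1} ‖D^m Φ‖²`. -/
private theorem sum_sq_fderiv_le_four_mul (Φ : E4 → ℝ) (x : E4) :
    ∑ μ, fderiv ℝ Φ x (E4.basisVector μ) ^ 2 ≤
      4 * ∑ m ∈ Finset.range (1 + 1), ‖iteratedFDeriv ℝ m Φ x‖ ^ 2 := by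
  have h1 : ∑ μ, fderiv ℝ Φ x (E4.basisVector μ) ^ 2 ≤ ∑ _μ : Fin 4, ‖iteratedFDeriv ℝ 1 Φ x‖ ^ 2 :=
    Finset.sum_le_sum fun μ _ ↦ sq_fderiv_basisVector_le Φ x μ
  have h2 : ∑ _μ : Fin 4, ‖iteratedFDeriv ℝ 1 Φ x‖ ^ 2 = 4 * ‖iteratedFDeriv ℝ 1 Φ x‖ ^ 2 := by
    simp
  rw [Finset.sum_range_succ, Finset.sum_range_succ, Finset.sum_range_zero, zero_add]
  nlinarith [sq_nonneg ‖iteratedFDeriv ℝ 0 Φ x‖]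

/-- **S7 · `stub_energyFromLocalEnergy`** — `a`-uniform energy boundedness modulo integrated local
energy on sub-extremal Kerr: for every `M > 0` there are `R₀ = 3M` and `C₀ = C₀(M) < ∞` such that for
every `|a| < M`, every admissible wave `ψ` on the Kerr exterior and every `τ ≥ 0`,
`sliceEnergy(ψ, τ) ≤ C₀ · (E₁[ψ](0) + ∫_{(0,∞)} localSliceEnergy(ψ, s, R₀) ds)`. Proof:
`Kerr.exterior_coordEnergy_le_local` (energy identity of the blended `T`/`∇t` current with the
receding horizon weight; Dafermos–Rodnianski arXiv:0811.0354 §4.1, §5.2; DRSR arXiv:1402.7034 §13,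
first reduction) for the representative of `ψ`, finite speed of propagation
(`kerr_finite_speed_of_propagation_holds`) for the spatially compact support on the slab, and
`∑_μ (∂_μΦ)² ≤ 4 ∑_{m ≤ 1} ‖D^mΦ‖²` for the data term. -/
theorem stub_energyFromLocalEnergy :
    (∀ [Kerr.Facts] [Kerr.SliceFacts], ∀ M : ℝ, 0 < M → ∃ (R₀ : ℝ) (C₀ : ENNReal), C₀ < ⊤ ∧ ∀ a : ℝ, Kerr.IsSubextremal M a → ∀ ψ : Kerr.exterior M a → ℝ, (ContMDiff 𝓘(ℝ, E4) 𝓘(ℝ, ℝ) ((⊤ : ℕ∞) : WithTop ℕ∞) ψ ∧ (∀ x, (Kerr.smoothMetric M a (Kerr.rPlus M a)).toPseudoRiemannianMetric.dalembertian ψ x = 0) ∧ ∃ K : Set (Kerr.exterior M a), IsCompact K ∧ ∀ x : Kerr.exterior M a, (x : E4) 0 = 0 → x ∉ K → ψ x = 0 ∧ mfderiv 𝓘(ℝ, E4) 𝓘(ℝ, ℝ) ψ x = 0) → ∀ τ : ℝ, 0 ≤ τ → sliceEnergy (Kerr.exterior M a) ψ τ ≤ C₀ * ((∫⁻ y : E3,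 {y | E4.ofTimeSpace 0 y ∈ Kerr.exterior M a}.indicator (fun y ↦ ENNReal.ofReal (∑ m ∈ Finset.range (1 + 1), ‖iteratedFDeriv ℝ m (Function.extend Subtype.val ψ (0 : E4 → ℝ)) (E4.ofTimeSpace 0 y)‖ ^ 2)) y) + ∫⁻ s in Ioi (0 : ℝ), localSliceEnergy (Kerr.exterior M a) ψ s R₀)) := by
  intro _ _ M hM
  obtain ⟨C, -, hmain⟩ := Kerr.exterior_coordEnergy_le_local hM
  refine ⟨3 * M, ENNReal.ofReal (4 * C), ENNReal.ofReal_lt_top, fun a hMa ψ hψ τ hτ ↦ ?_⟩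
  obtain ⟨hsmooth, hwave, K, hK, hdata⟩ := hψ
  -- the representative of `ψ` and its equation
  set Φ : E4 → ℝ := Function.extend Subtype.val ψ 0 with hΦ
  have hrep : ∀ y, ψ y = Φ y := extend_rep ψ
  have hΦ2 : ∀ z ∈ (Kerr.exterior M a : Set E4), ContDiffAt ℝ 2 Φ z := fun z hz ↦
    (contDiffAt_extend hsmooth ⟨z, hz⟩).of_le (WithTop.coe_le_coe.mpr le_top)
  have hsol : ∀ z ∈ (Kerr.exterior M a : Set E4),
      KerrSchild.waveOperator (KerrSchild.inverseMetric (fun y ↦ 2 * Kerr.scalarH M a y)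
        (Kerr.nullVector a)) Φ z = 0 := by
    intro z hz
    rw [← Kerr.dalembertian_eq_waveOperator M a (Kerr.rPlus M a) hrep ⟨z, hz⟩ (hΦ2 z hz)]
    exact hwave ⟨z, hz⟩
  -- finite speed of propagation: `dΦ = 0` on the slab beyond `‖x⃗‖ = ρ + τ`
  obtain ⟨ρ, -, hρK⟩ := exists_spatialNorm_le_of_isCompact hK
  have hdata' : ∀ x : Kerr.exterior M a, (x : E4) 0 = 0 → ρ < E4.spatialNorm (x : E4) →
      ψ x = 0 ∧ mfderiv 𝓘(ℝ, E4) 𝓘(ℝ, ℝ) ψ x = 0 := fun x hx0 hxρ ↦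
    hdata x hx0 fun hxK ↦ (not_le.mpr hxρ) (hρK x hxK)
  have hfsp := kerr_finite_speed_of_propagation_holds M a hMa ψ hsmooth hwave ρ hdata'
  have hfar : ∀ x ∈ (Kerr.exterior M a : Set E4), 0 ≤ x 0 → x 0 ≤ τ →
      ρ + τ < E4.spatialNorm x → fderiv ℝ Φ x = 0 := fun x hx h0 h1 h2 ↦
    Kerr.fderiv_extend_eq_zero (by simp) hsmooth ⟨x, hx⟩ (hfsp ⟨x, hx⟩ h0 (by
      show ρ + x 0 < E4.spatialNorm x; linarith)).2
  have hE := hmain a hMa Φ hΦ2 hsol (ρ + τ) τ hτ hfar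
  -- the three terms of the statement, in coordinate form
  have hEτ : sliceEnergy (Kerr.exterior M a) ψ τ =
      ∫⁻ y, {y : E3 | E4.ofTimeSpace τ y ∈ Kerr.exterior M a}.indicator
        (fun y ↦ ENNReal.ofReal (∑ μ, fderiv ℝ Φ (E4.ofTimeSpace τ y) (E4.basisVector μ) ^ 2)) y :=
    rfl
  have hEloc : ∀ t, localSliceEnergy (Kerr.exterior M a) ψ t (3 * M) =
      ∫⁻ y in Metric.closedBall (0 : E3) (3 * M), {y : E3 | E4.ofTimeSpace t y ∈ Kerr.exterior M a}.indicator
        (fun y ↦ ENNReal.ofReal (∑ μ, fderiv ℝ Φ (E4.ofTimeSpace t y) (E4.basisVector μ) ^ 2)) y :=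
    fun t ↦ rfl
  set E₁ : ℝ≥0∞ := ∫⁻ y : E3, {y | E4.ofTimeSpace 0 y ∈ Kerr.exterior M a}.indicator (fun y ↦
    ENNReal.ofReal (∑ m ∈ Finset.range (1 + 1), ‖iteratedFDeriv ℝ m Φ (E4.ofTimeSpace 0 y)‖ ^ 2)) y
    with hE₁
  set I : ℝ≥0∞ := ∫⁻ s in Ioi (0 : ℝ), localSliceEnergy (Kerr.exterior M a) ψ s (3 * M) with hI
  -- (iii) the data energy
  have hdataE : (∫⁻ y, {y : E3 | E4.ofTimeSpace 0 y ∈ Kerr.exterior M a}.indicator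
      (fun y ↦ ENNReal.ofReal (∑ μ, fderiv ℝ Φ (E4.ofTimeSpace 0 y) (E4.basisVector μ) ^ 2)) y) ≤
      4 * E₁ := by
    rw [hE₁, ← lintegral_const_mul' _ _ (by norm_num : (4 : ℝ≥0∞) ≠ ⊤)]
    refine lintegral_mono fun y ↦ ?_
    by_cases hy : y ∈ {y : E3 | E4.ofTimeSpace 0 y ∈ Kerr.exterior M a}
    · rw [indicator_of_mem hy, indicator_of_mem hy, ← ENNReal.ofReal_ofNat 4,
        ← ENNReal.ofReal_mul (by norm_num)]
      exact ENNReal.ofReal_le_ofReal (sum_sq_fderiv_le_four_mul Φ _)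
    · rw [indicator_of_notMem hy, indicator_of_notMem hy, mul_zero]
  -- (iv) the time integral
  have hIle : (∫⁻ t in Ioc (0 : ℝ) τ, ∫⁻ y in Metric.closedBall (0 : E3) (3 * M),
      {y : E3 | E4.ofTimeSpace t y ∈ Kerr.exterior M a}.indicator
        (fun y ↦ ENNReal.ofReal (∑ μ, fderiv ℝ Φ (E4.ofTimeSpace t y) (E4.basisVector μ) ^ 2)) y) ≤ I := by
    rw [hI]
    exact lintegral_mono_set Ioc_subset_Ioi_self
  -- assemble
  have h4 : 4 * E₁ + I ≤ 4 * (E₁ + I) := by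
    rw [mul_add]
    refine add_le_add le_rfl ?_
    calc I = 1 * I := (one_mul I).symm
      _ ≤ 4 * I := mul_le_mul' (by norm_num) le_rfl
  calc sliceEnergy (Kerr.exterior M a) ψ τ
      ≤ ENNReal.ofReal C * ((∫⁻ y, {y : E3 | E4.ofTimeSpace 0 y ∈ Kerr.exterior M a}.indicator
          (fun y ↦ ENNReal.ofReal (∑ μ, fderiv ℝ Φ (E4.ofTimeSpace 0 y) (E4.basisVector μ) ^ 2)) y) +
          ∫⁻ t in Ioc (0 : ℝ) τ, ∫⁻ y in Metric.closedBall (0 : E3) (3 * M),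
            {y : E3 | E4.ofTimeSpace t y ∈ Kerr.exterior M a}.indicator
              (fun y ↦ ENNReal.ofReal (∑ μ, fderiv ℝ Φ (E4.ofTimeSpace t y) (E4.basisVector μ) ^ 2)) y) := by
        rw [hEτ]; exact hE
    _ ≤ ENNReal.ofReal C * (4 * E₁ + I) := mul_le_mul' le_rfl (add_le_add hdataE hIle)
    _ ≤ ENNReal.ofReal C * (4 * (E₁ + I)) := mul_le_mul' le_rfl h4
    _ = ENNReal.ofReal (4 * C) * (E₁ + I) := by
        rw [ENNReal.ofReal_mul (by norm_num : (0 : ℝ) ≤ 4), ENNReal.ofReal_ofNat]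
        ring

end Summit.FinalStateConjecture.FinalStateConjecture.Theorems.KappaExplicitWaveDecay.OlverDunsterUniformReduction

end
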